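import Mathlib
import Summits.AtomisticToContinuum.Crystallization.Theses.PlanarOrderLadder

/-!
# BC5 rung for the deciding crux `MesoscopicPlanarOrder` of route `PlanarOrderLadder`

`MesoscopicPlanarOrder` HOLDS for every ground-state sequence whose hull contains a `δ`-separated, relatively dense hull
point that is `δ/8`-wobbling-equivalent to a set `Z` with TWO exact independent periods (lengths in `[δ, b]`, transversal
margin `δ`) — the WOBBLED / MODULATED BI-PERIODIC regime (smectic-like stacks of wobbled crystalline planes; no third period
assumed), where neither `Crystallization` nor any exact-period statement of the lineage (items 24144, 24145) is known: a
wobbled hull point has no exact period without lock-in.  The coarse tolerance `δ/4` absorbs the wobble and the SAME pair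
serves every centre — the route's lever (rank two at the mesoscale, coarse precision) at work.  `mesoscopicPlanarOrder_rung`
is literally the crux with its Delone-hull-point hypothesis strengthened to the regime hypothesis.  No sorry.
-/

namespace Summit.AtomisticToContinuum.Crystallization.Theorems.PlanarOrderLadderMesoscopicPlanarOrderRung

/-- The wobbled bi-periodic regime implies the conclusion of `MesoscopicPlanarOrder` (pure geometry). -/
theorem m2concl_of_wobbled (x : (N : ℕ) → (Fin N → EuclideanSpace ℝ (Fin 3))) (h : ∃ X Z : Set (EuclideanSpace ℝ (Fin 3)), ∃ δ r b : ℝ, 0 < δ ∧ (∀ p ∈ X, ∀ q ∈ X, p ≠ q → δ ≤ dist p q) ∧ (∀ c : EuclideanSpace ℝ (Fin 3), ∃ p ∈ X, dist p c ≤ r) ∧ (∀ R ε : ℝ, 0 < ε → ∃ᶠ N in Filter.atTop, ∃ t : EuclideanSpace ℝ (Fin 3), (∀ p ∈ X, ‖p‖ ≤ R → ∃ i : Fin N, dist (x N i + t) p ≤ ε) ∧ (∀ i : Fin N, ‖x N i + t‖ ≤ R → ∃ p ∈ X, dist (x N i + t) p ≤ ε)) ∧ (∃ t₁ t₂ : EuclideanSpace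 ℝ (Fin 3), δ ≤ ‖t₁‖ ∧ ‖t₁‖ ≤ b ∧ ‖t₂‖ ≤ b ∧ (∀ s : ℝ, δ ≤ ‖t₂ - s • t₁‖) ∧ ∀ z ∈ Z, (z + t₁ ∈ Z ∧ z - t₁ ∈ Z) ∧ (z + t₂ ∈ Z ∧ z - t₂ ∈ Z)) ∧ (∀ p ∈ X, ∃ z ∈ Z, dist p z ≤ δ / 8) ∧ (∀ z ∈ Z, ∃ p ∈ X, dist z p ≤ δ / 8)) :
    ∃ X : Set (EuclideanSpace ℝ (Fin 3)), ∃ δ r b : ℝ, 0 < δ ∧ (∀ p ∈ X, ∀ q ∈ X, p ≠ q → δ ≤ dist p q) ∧ (∀ c : EuclideanSpace ℝ (Fin 3), ∃ p ∈ X, dist p c ≤ r) ∧ (∀ R ε : ℝ, 0 < ε → ∃ᶠ N in Filter.atTop, ∃ t : EuclideanSpace ℝ (Fin 3), (∀ p ∈ X, ‖p‖ ≤ R → ∃ i : Fin N, dist (x N i + t) p ≤ ε) ∧ (∀ i : Fin N, ‖x N i + t‖ ≤ R → ∃ p ∈ X, dist (x N i + t) p ≤ ε)) ∧ ∀ c :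 EuclideanSpace ℝ (Fin 3), ∃ t₁ t₂ : EuclideanSpace ℝ (Fin 3), δ ≤ ‖t₁‖ ∧ ‖t₁‖ ≤ b ∧ ‖t₂‖ ≤ b ∧ (∀ s : ℝ, δ ≤ ‖t₂ - s • t₁‖) ∧ ∀ p ∈ X, dist p c ≤ 4 * b → (∃ q ∈ X, dist (p + t₁) q ≤ δ / 4) ∧ (∃ q ∈ X, dist (p - t₁) q ≤ δ / 4) ∧ (∃ q ∈ X, dist (p + t₂) q ≤ δ / 4) ∧ (∃ q ∈ X, dist (p - t₂) q ≤ δ / 4) := by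
  obtain ⟨X, Z, δ, r, b, hδ, hsep, hden, hhull, ⟨t₁, t₂, h1, h1b, h2b, hmar, hper⟩, hXZ, hZX⟩ := h
  refine ⟨X, δ, r, b, hδ, hsep, hden, hhull, fun c => ⟨t₁, t₂, h1, h1b, h2b, hmar, fun p hp _ => ?_⟩⟩
  obtain ⟨z, hz, hpz⟩ := hXZ p hp
  have key : ∀ t : EuclideanSpace ℝ (Fin 3), z + t ∈ Z → z - t ∈ Z →
      (∃ q ∈ X, dist (p + t) q ≤ δ / 4) ∧ (∃ q ∈ X, dist (p - t) q ≤ δ / 4) := by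
    intro t h1 h2
    obtain ⟨q₁, hq₁, hzq₁⟩ := hZX (z + t) h1
    obtain ⟨q₂, hq₂, hzq₂⟩ := hZX (z - t) h2
    refine ⟨⟨q₁, hq₁, ?_⟩, ⟨q₂, hq₂, ?_⟩⟩
    · calc dist (p + t) q₁ ≤ dist (p + t) (z + t) + dist (z + t) q₁ := dist_triangle _ _ _
        _ = dist p z + dist (z + t) q₁ := by rw [dist_add_right]
        _ ≤ δ / 8 + δ / 8 := add_le_add hpz hzq₁
        _ ≤ δ / 4 := by linarith
    · calc dist (p - t) q₂ ≤ dist (p - t) (z - t) + dist (z - t) q₂ := dist_triangle _ _ _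
        _ = dist p z + dist (z - t) q₂ := by rw [dist_sub_right]
        _ ≤ δ / 8 + δ / 8 := add_le_add hpz hzq₂
        _ ≤ δ / 4 := by linarith
  obtain ⟨k1, k2⟩ := key t₁ (hper z hz).1.1 (hper z hz).1.2
  exact ⟨k1, k2, key t₂ (hper z hz).2.1 (hper z hz).2.2⟩

/-- **BC5 rung.** `MesoscopicPlanarOrder` restricted to the wobbled bi-periodic regime, as a closed theorem
(the Delone-hull-point hypothesis of the crux is implied by the regime hypothesis and dropped). -/
theorem mesoscopicPlanarOrder_rung :
    ∀ x : (N : ℕ) → (Fin N → EuclideanSpace ℝ (Fin 3)), (∀ N, Literature.MathematicalPhysics.StatisticalMechanics.IsGroundState Literature.MathematicalPhysics.StatisticalMechanics.lennardJones (x N)) → (∃ X Z : Set (EuclideanSpace ℝ (Fin 3)), ∃ δ r b : ℝ, 0 < δ ∧ (∀ p ∈ X, ∀ q ∈ X, p ≠ q → δ ≤ dist p q) ∧ (∀ c : EuclideanSpace ℝ (Fin 3), ∃ p ∈ X, dist p c ≤ r) ∧ (∀ R ε : ℝ, 0 < ε → ∃ᶠ N in Filter.atTop, ∃ t : EuclideanSpace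 ℝ (Fin 3), (∀ p ∈ X, ‖p‖ ≤ R → ∃ i : Fin N, dist (x N i + t) p ≤ ε) ∧ (∀ i : Fin N, ‖x N i + t‖ ≤ R → ∃ p ∈ X, dist (x N i + t) p ≤ ε)) ∧ (∃ t₁ t₂ : EuclideanSpace ℝ (Fin 3), δ ≤ ‖t₁‖ ∧ ‖t₁‖ ≤ b ∧ ‖t₂‖ ≤ b ∧ (∀ s : ℝ, δ ≤ ‖t₂ - s • t₁‖) ∧ ∀ z ∈ Z, (z + t₁ ∈ Z ∧ z - t₁ ∈ Z) ∧ (z + t₂ ∈ Z ∧ z - t₂ ∈ Z)) ∧ (∀ p ∈ X, ∃ z ∈ Z, dist p z ≤ δ / 8) ∧ (∀ z ∈ Z, ∃ p ∈ X, dist z p ≤ δ / 8)) → ∃ X : Set (EuclideanSpace ℝ (Fin 3)), ∃ δ r b : ℝ, 0 < δ ∧ (∀ p ∈ X, ∀ q ∈ X, p ≠ q → δ ≤ dist p q) ∧ (∀ c : EuclideanSpace ℝ (Fin 3), ∃ p ∈ X, dist p c ≤ r) ∧ (∀ R ε : ℝ, 0 < ε → ∃ᶠ N in Filter.atTop, ∃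 t : EuclideanSpace ℝ (Fin 3), (∀ p ∈ X, ‖p‖ ≤ R → ∃ i : Fin N, dist (x N i + t) p ≤ ε) ∧ (∀ i : Fin N, ‖x N i + t‖ ≤ R → ∃ p ∈ X, dist (x N i + t) p ≤ ε)) ∧ ∀ c : EuclideanSpace ℝ (Fin 3), ∃ t₁ t₂ : EuclideanSpace ℝ (Fin 3), δ ≤ ‖t₁‖ ∧ ‖t₁‖ ≤ b ∧ ‖t₂‖ ≤ b ∧ (∀ s : ℝ, δ ≤ ‖t₂ - s • t₁‖) ∧ ∀ p ∈ X, dist p c ≤ 4 * b → (∃ q ∈ X, dist (p + t₁) q ≤ δ / 4) ∧ (∃ q ∈ X, dist (p - t₁) q ≤ δ / 4) ∧ (∃ q ∈ X, dist (p + t₂) q ≤ δ / 4) ∧ (∃ q ∈ X, dist (p - t₂) q ≤ δ / 4) :=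
  fun x _ h => m2concl_of_wobbled x h


/-- The rung's conclusion is the conclusion of the route decl `MesoscopicPlanarOrder` (same text), so the crux follows on the
regime from the rung by dropping the Delone-hull-point hypothesis. -/
theorem mesoscopicPlanarOrder_on_wobbled_regime
    (x : (N : ℕ) → (Fin N → EuclideanSpace ℝ (Fin 3)))
    (hx : (∀ N, Literature.MathematicalPhysics.StatisticalMechanics.IsGroundState Literature.MathematicalPhysics.StatisticalMechanics.lennardJones (x N)))
    (hreg : ∃ X Z : Set (EuclideanSpace ℝ (Fin 3)), ∃ δ r b : ℝ, 0 < δ ∧ (∀ p ∈ X, ∀ q ∈ X, p ≠ q → δ ≤ dist p q) ∧ (∀ c : EuclideanSpace ℝ (Fin 3), ∃ p ∈ X, dist p c ≤ r) ∧ (∀ R ε : ℝ, 0 < ε → ∃ᶠ N in Filter.atTop, ∃ t : EuclideanSpace ℝ (Fin 3), (∀ p ∈ X, ‖p‖ ≤ R → ∃ i : Fin N, dist (x N i + t) p ≤ ε) ∧ (∀ i : Fin N, ‖x N i + t‖ ≤ R → ∃ p ∈ X, dist (x N i + t) p ≤ ε)) ∧ (∃ t₁ t₂ : EuclideanSpace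 ℝ (Fin 3), δ ≤ ‖t₁‖ ∧ ‖t₁‖ ≤ b ∧ ‖t₂‖ ≤ b ∧ (∀ s : ℝ, δ ≤ ‖t₂ - s • t₁‖) ∧ ∀ z ∈ Z, (z + t₁ ∈ Z ∧ z - t₁ ∈ Z) ∧ (z + t₂ ∈ Z ∧ z - t₂ ∈ Z)) ∧ (∀ p ∈ X, ∃ z ∈ Z, dist p z ≤ δ / 8) ∧ (∀ z ∈ Z, ∃ p ∈ X, dist z p ≤ δ / 8))
    (_h0 : ∃ X : Set (EuclideanSpace ℝ (Fin 3)), ((∃ δ : ℝ, 0 < δ ∧ ∀ p ∈ X, ∀ q ∈ X, p ≠ q → δ ≤ dist p q) ∧ (∃ r : ℝ, ∀ c : EuclideanSpace ℝ (Fin 3), ∃ p ∈ X, dist p c ≤ r)) ∧ (∀ R ε : ℝ, 0 < ε → ∃ᶠ N in Filter.atTop, ∃ t : EuclideanSpace ℝ (Fin 3), (∀ p ∈ X, ‖p‖ ≤ R → ∃ i : Fin N, dist (x N i + t) p ≤ ε) ∧ (∀ i : Fin N, ‖x N i + t‖ ≤ R → ∃ p ∈ X, dist (x N i + t) p ≤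 ε))) :
    ∃ X : Set (EuclideanSpace ℝ (Fin 3)), ∃ δ r b : ℝ, 0 < δ ∧ (∀ p ∈ X, ∀ q ∈ X, p ≠ q → δ ≤ dist p q) ∧ (∀ c : EuclideanSpace ℝ (Fin 3), ∃ p ∈ X, dist p c ≤ r) ∧ (∀ R ε : ℝ, 0 < ε → ∃ᶠ N in Filter.atTop, ∃ t : EuclideanSpace ℝ (Fin 3), (∀ p ∈ X, ‖p‖ ≤ R → ∃ i : Fin N, dist (x N i + t) p ≤ ε) ∧ (∀ i : Fin N, ‖x N i + t‖ ≤ R → ∃ p ∈ X, dist (x N i + t) p ≤ ε)) ∧ ∀ c : EuclideanSpace ℝ (Fin 3), ∃ t₁ t₂ : EuclideanSpace ℝ (Fin 3), δ ≤ ‖t₁‖ ∧ ‖t₁‖ ≤ b ∧ ‖t₂‖ ≤ b ∧ (∀ s : ℝ, δ ≤ ‖t₂ - s • t₁‖) ∧ ∀ p ∈ X, dist p c ≤ 4 * b → (∃ q ∈ X, dist (p + t₁) q ≤ δ / 4) ∧ (∃ q ∈ X, dist (p - t₁) q ≤ δ / 4) ∧ (∃ q ∈ X, dist (p + t₂) q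 ≤ δ / 4) ∧ (∃ q ∈ X, dist (p - t₂) q ≤ δ / 4) :=
  mesoscopicPlanarOrder_rung x hx hreg

end Summit.AtomisticToContinuum.Crystallization.Theorems.PlanarOrderLadderMesoscopicPlanarOrderRung
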